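import Mathlib
import HarnessLib
import Summits.CriticalPhenomena.PercolationContinuityZ3.Theorems.PercNearOneGluingNoHeavyLowerTailTwoCopyLadderAllGradesRail
import Summits.CriticalPhenomena.PercolationContinuityZ3.Theorems.PercNearOneGluingNoHeavyLowerTailTwoCopyLadderAllGradesLemmaQMain

/-!
# Every wheel is Potts–Rayleigh on `(0,1]` (THEOREM W∞) — the algebraic forms

Helper file for crux `stmt-CriticalPhenomena-4575` (new-inequality factory `prim-ineq-gen-1`, gen 22); memo
`run/shared/lean/prim/prim-ineq-gen-1/FINDING-30-wheels.md`.

The observation of this file: a FAN (hub `h`, rim path `x₀, x₁, …, x_k`, all spokes) is a 3-terminal side of the orbit `Orb` of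
`…TwoCopyLadderAllGradesSide` when the HUB is taken as a terminal — apex `x₀`, `w = h` (the spoke `hx₀` is the first move `qpendW`),
`u` = the current rim end (each further rim vertex is a `qpendU`, each further spoke a `rungStep`) — see `fanW` (and `fanU`, the
mirror with `u = h`).  Consequently the three all-grade two-copy forms of gens 19–20 — the SPOKE form `Qspoke` (adjacent pairs at a
degree-3 vertex), the RAIL form `Frail` (two sides sharing `w`, `f` joining their `u`-terminals) and the RUNG form `Bhat` (two
sides glued at `u, w`, `f = uw`) — evaluate the two-copy cores `P_{W_n; e, f}(q;y)/q³` of the wheel `W_n` (`n ≥ 4` rim vertices,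
arbitrary nonnegative rim weights `r_i` and spoke weights `s_i`) for the pair classes

* (i)   rim–rim adjacent `(x_{n-1}x₀, x₀x₁)`:      `Qspoke q s₀ (fanW …)`     (`K = W_n − x₀`, apex `x₁`, `w = h`, `u` walks `x₂ … x_{n-1}`),
* (ii)  rim–spoke incident `(x₀x₁, hx₀)`:          `Qspoke q r_{n-1} (fanU …)` (the same fan with `u = h`),
* (iv)  rim–spoke non-incident `(x₀x₁, hx_k)`:     `Bhat q (fanW …) (fanW …)`  (the two fans from `x₀` resp. `x₁` to `x_k`, `f` = the rung `hx_k`),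
* (v)   rim–rim non-adjacent `(x₀x₁, x_jx_{j+1})`: `Frail q (fanW …) (fanW …)` (the two fans from `x₀` to `x_{j+1}` resp. `x₁` to `x_j`, sharing `w = h`),

(exact polynomial identities `q³·form = P_{e,f}` in all `2n` weights and `q`, and fan q-type vectors by the moves = brute force,
verified for `W₄, W₅, W₆`: memo §1, `code-gen22/work/wheels.py`; the universal forms themselves are derived for arbitrary sides), while
the two spoke–spoke classes (iii) `(hx₀, hx₁)`, (vi) `(hx₀, hx_k)` are the planar duals of (i), (v) (`W_n ≅ W_n^*`, rim ↔ spokes; edge-pair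
Rayleigh at fixed `q` for all positive weights is invariant under planar duality `y ↦ q/y`).  Hence, from `Qspoke_pos`, `Frail_pos`
(all `q ≥ 0`, even coefficientwise in `q`) and the rung theorem `Bhat ≥ 0` on `Orb × Orb` for `0 ≤ q ≤ 1` (LEMMA Q, `Qsym_nonneg_of_orb`,
with `Bhat_nonneg_of_Qsym`; stated here once as `Bhat_nonneg_of_orb`):

**THEOREM W∞.** For every `n ≥ 3`, every `q ∈ (0,1]` and all positive edge weights, the random-cluster measure on the wheel `W_n` is
edge-negatively correlated for EVERY pair of edges (`W_n` is Potts–Rayleigh on the whole interval; `W₃ = K₄` is Sokal's computation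
reported in Wagner 2008, `W₄, W₅` were certified by sums of squares in gen 18).  With 2-sums (Wagner 2008, Thm 5.8) and minors: every graph
whose 3-connected torsos are wheels is Potts–Rayleigh on `(0,1]` — the first infinite family of 3-connected graphs beyond `K₄`.

This file proves the form-level statements (kernel-checked); the identification with the graph polynomials is census-level, as in the
parent files.  (This work, 2026-08-22.)
-/

namespace Summit.CriticalPhenomena.PercolationContinuityZ3.Theorems

namespace TwoCopyWheels

open TwoCopyLadderCubic TwoCopyLadderAllGrades

variable {R : Type*} [CommRing R]

/-- The q-type vector of a FAN with the hub at the terminal `w`: the apex is the first rim vertex `x₀`, joined to the hub by the spoke of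
weight `s₀` (`qpendW`); each list entry `(r, t)` adds the next rim vertex (a q-pendant edge of weight `r` at `u`) and its spoke
(a terminal rung of weight `t`; `t = 0` = no spoke).  The head of the list is the LAST rim vertex `u`. [this work] -/
def fanW (q s₀ : R) : List (R × R) → SVec R
  | [] => qpendW q s₀ triv
  | (r, t) :: cols => rungStep t (qpendU q r (fanW q s₀ cols))

/-- The mirror fan with the hub at the terminal `u` (`qpendU` for the first spoke, `qpendW` for the rim edges). [this work] -/
def fanU (q s₀ : R) : List (R × R) → SVec R
  | [] => qpendU q s₀ triv
  | (r, t) :: cols => rungStep t (qpendW q r (fanU q s₀ cols))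

/-- The `p`-entry (`[x₀ u | h]`) of `fanW` is the product of the rim weights. [this work] -/
theorem fanW_p (q s₀ : R) : ∀ cols : List (R × R), (fanW q s₀ cols).p = (cols.map Prod.fst).prod
  | [] => by simp [fanW, qpendW, triv]
  | (r, t) :: cols => by simp [fanW, rungStep, qpendU, fanW_p q s₀ cols]

/-- The `m`-entry (`[x₀ w | h]`) of `fanU` is the product of the rim weights. [this work] -/
theorem fanU_m (q s₀ : R) : ∀ cols : List (R × R), (fanU q s₀ cols).m = (cols.map Prod.fst).prod
  | [] => by simp [fanU, qpendU, triv]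
  | (r, t) :: cols => by simp [fanU, rungStep, qpendW, fanU_m q s₀ cols]

section Cone

variable {P : R → Prop}

/-- Fans (hub at `w`) lie in the orbit `Orb`. [this work] -/
theorem orb_fanW {q s₀ : R} (hs₀ : P s₀) :
    ∀ cols : List (R × R), (∀ rt ∈ cols, P rt.1 ∧ P rt.2) → Orb P q (fanW q s₀ cols)
  | [], _ => by
      show Orb P q (qpendW q s₀ triv)
      exact Orb.pendW hs₀ Orb.triv
  | (r, t) :: cols, h => by
      have hcols : ∀ rt ∈ cols, P rt.1 ∧ P rt.2 := fun rt hrt => h rt (List.mem_cons_of_mem _ hrt)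
      obtain ⟨hr, ht⟩ := h (r, t) List.mem_cons_self
      exact Orb.rung ht (Orb.pendU hr (orb_fanW hs₀ cols hcols))

/-- Fans (hub at `u`) lie in the orbit `Orb`. [this work] -/
theorem orb_fanU {q s₀ : R} (hs₀ : P s₀) :
    ∀ cols : List (R × R), (∀ rt ∈ cols, P rt.1 ∧ P rt.2) → Orb P q (fanU q s₀ cols)
  | [], _ => by
      show Orb P q (qpendU q s₀ triv)
      exact Orb.pendU hs₀ Orb.triv
  | (r, t) :: cols, h => by
      have hcols : ∀ rt ∈ cols, P rt.1 ∧ P rt.2 := fun rt hrt => h rt (List.mem_cons_of_mem _ hrt)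
      obtain ⟨hr, ht⟩ := h (r, t) List.mem_cons_self
      exact Orb.rung ht (Orb.pendW hr (orb_fanU hs₀ cols hcols))

/-- Class (i), rim–rim ADJACENT pairs `(x_{n-1}x₀, x₀x₁)` of the wheel (cone form): the spoke form of the fan `W_n − x₀` (apex `x₁`,
hub at `w`) with `y = s₀` the spoke at the common vertex lies in the cone — all `q` in the cone, coefficientwise. [this work] -/
theorem wheel_rimRimAdj_pos (hP : IsPosCone P) {q y s₁ : R} (hq : P q) (hy : P y) (hs₁ : P s₁) (cols : List (R × R))
    (h : ∀ rt ∈ cols, P rt.1 ∧ P rt.2) : P (Qspoke q y (fanW q s₁ cols)) :=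
  Qspoke_pos hP hq hy (orb_fanW hs₁ cols h)

/-- Class (ii), rim–spoke INCIDENT pairs `(x₀x₁, hx₀)` of the wheel (cone form): the spoke form of the fan `W_n − x₀` (apex `x₁`, hub at
`u`) with `y = r_{n-1}` the other rim edge at `x₀` lies in the cone. [this work] -/
theorem wheel_rimSpokeInc_pos (hP : IsPosCone P) {q y s₁ : R} (hq : P q) (hy : P y) (hs₁ : P s₁) (cols : List (R × R))
    (h : ∀ rt ∈ cols, P rt.1 ∧ P rt.2) : P (Qspoke q y (fanU q s₁ cols)) :=
  Qspoke_pos hP hq hy (orb_fanU hs₁ cols h)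

/-- Class (v), rim–rim NON-ADJACENT pairs `(x₀x₁, x_jx_{j+1})`, `2 ≤ j ≤ n−2` (cone form): the rail form of the two fans from `x₀` to
`x_{j+1}` and from `x₁` to `x_j` (hub = the shared terminal `w`, `f = x_jx_{j+1}` joins their `u`-terminals) lies in the cone. [this work] -/
theorem wheel_rimRim_pos (hP : IsPosCone P) {q s₀ s₁ : R} (hq : P q) (hs₀ : P s₀) (hs₁ : P s₁) (cols cols' : List (R × R))
    (h : ∀ rt ∈ cols, P rt.1 ∧ P rt.2) (h' : ∀ rt ∈ cols', P rt.1 ∧ P rt.2) :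
    P (Frail q (fanW q s₀ cols) (fanW q s₁ cols')) :=
  Frail_pos hP hq (orb_fanW hs₀ cols h) (orb_fanW hs₁ cols' h')

end Cone

section Ordered

variable {S : Type*} [CommRing S] [LinearOrder S] [IsStrictOrderedRing S]

/-- THE REAL-q RUNG THEOREM ON `Orb × Orb`: for `0 ≤ q ≤ 1` and any two sides of the orbit with nonnegative weights and `p + m > 0`,
the rung form `Bhat` (`= P_{X ∪_{u,w} Y + av; av, uw}/q³`) is nonnegative — LEMMA Q (`Qsym_nonneg_of_orb`) fed into the
q-polarization reduction `Bhat_nonneg_of_Qsym`. [this work] -/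
theorem Bhat_nonneg_of_orb {q : S} (hq0 : 0 ≤ q) (hq1 : q ≤ 1) {X Y : SVec S} (hX : Orb (fun x : S => 0 ≤ x) q X)
    (hY : Orb (fun x : S => 0 ≤ x) q Y) (hαX : 0 < X.p + X.m) (hαY : 0 < Y.p + Y.m) : 0 ≤ Bhat q X Y :=
  Bhat_nonneg_of_Qsym hq0 hq1 (goodK_of_orb hq0 hX).hN (goodK_of_orb hq0 hY).hN hαX hαY (Qsym_nonneg_of_orb hq0 hq1 hX)
    (Qsym_nonneg_of_orb hq0 hq1 hY)

/-- On a fan with positive rim weights `p + m > 0` (`p` is the product of the rim weights). [this work] -/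
theorem fanW_pm_pos {q s₀ : S} (hq : 0 ≤ q) (hs₀ : 0 ≤ s₀) (cols : List (S × S)) (h : ∀ rt ∈ cols, 0 < rt.1 ∧ 0 ≤ rt.2) :
    0 < (fanW q s₀ cols).p + (fanW q s₀ cols).m := by
  have hw : ∀ rt ∈ cols, 0 ≤ rt.1 ∧ 0 ≤ rt.2 := fun rt hrt => ⟨(h rt hrt).1.le, (h rt hrt).2⟩
  have hm : 0 ≤ (fanW q s₀ cols).m := (goodK_of_orb hq (orb_fanW (P := fun x : S => 0 ≤ x) hs₀ cols hw)).hN.hm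
  have hp : 0 < (fanW q s₀ cols).p := by
    rw [fanW_p]
    refine List.prod_pos fun x hx => ?_
    obtain ⟨rt, hrt, rfl⟩ := List.mem_map.mp hx
    exact (h rt hrt).1
  linarith

/-- Class (iv), rim–spoke NON-INCIDENT pairs `(x₀x₁, hx_k)`, `k ∉ {0,1}`: for `0 ≤ q ≤ 1`, positive rim weights and nonnegative spoke
weights the rung form of the two fans from `x₀` resp. `x₁` to `x_k` (hub at `w`, last spoke weight `0`, `f = hx_k` the rung) is
nonnegative — Rayleigh negative correlation of a rim edge with every non-incident spoke at every `q ∈ (0,1)`. [this work] -/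
theorem wheel_rimSpoke_allq_nonneg {q s₀ s₁ : S} (hq0 : 0 ≤ q) (hq1 : q ≤ 1) (hs₀ : 0 ≤ s₀) (hs₁ : 0 ≤ s₁)
    (cols cols' : List (S × S)) (h : ∀ rt ∈ cols, 0 < rt.1 ∧ 0 ≤ rt.2) (h' : ∀ rt ∈ cols', 0 < rt.1 ∧ 0 ≤ rt.2) :
    0 ≤ Bhat q (fanW q s₀ cols) (fanW q s₁ cols') := by
  have hw : ∀ rt ∈ cols, 0 ≤ rt.1 ∧ 0 ≤ rt.2 := fun rt hrt => ⟨(h rt hrt).1.le, (h rt hrt).2⟩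
  have hw' : ∀ rt ∈ cols', 0 ≤ rt.1 ∧ 0 ≤ rt.2 := fun rt hrt => ⟨(h' rt hrt).1.le, (h' rt hrt).2⟩
  exact Bhat_nonneg_of_orb hq0 hq1 (orb_fanW hs₀ cols hw) (orb_fanW hs₁ cols' hw') (fanW_pm_pos hq0 hs₀ cols h)
    (fanW_pm_pos hq0 hs₁ cols' h')

/-- Class (v), real form: the rail form of two fans is `≥ 0` for every `q ≥ 0` and nonnegative weights — Rayleigh negative correlation of
two non-adjacent rim edges of every wheel at every `q ∈ (0,1)`. [this work] -/
theorem wheel_rimRim_allq_nonneg {q s₀ s₁ : S} (hq : 0 ≤ q) (hs₀ : 0 ≤ s₀) (hs₁ : 0 ≤ s₁) (cols cols' : List (S × S))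
    (h : ∀ rt ∈ cols, 0 ≤ rt.1 ∧ 0 ≤ rt.2) (h' : ∀ rt ∈ cols', 0 ≤ rt.1 ∧ 0 ≤ rt.2) :
    0 ≤ Frail q (fanW q s₀ cols) (fanW q s₁ cols') :=
  wheel_rimRim_pos (P := fun x : S => 0 ≤ x) isPosCone_nonneg hq hs₀ hs₁ cols cols' h h'

/-- Classes (i)/(ii), real form: the spoke forms of a fan (hub at `w` or at `u`) are `≥ 0` for every `q ≥ 0` and nonnegative weights —
Rayleigh negative correlation of two adjacent rim edges, and of a rim edge with an incident spoke, at every `q ∈ (0,1)`. [this work] -/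
theorem wheel_adjacent_allq_nonneg {q y s₁ : S} (hq : 0 ≤ q) (hy : 0 ≤ y) (hs₁ : 0 ≤ s₁) (cols : List (S × S))
    (h : ∀ rt ∈ cols, 0 ≤ rt.1 ∧ 0 ≤ rt.2) :
    0 ≤ Qspoke q y (fanW q s₁ cols) ∧ 0 ≤ Qspoke q y (fanU q s₁ cols) :=
  ⟨wheel_rimRimAdj_pos (P := fun x : S => 0 ≤ x) isPosCone_nonneg hq hy hs₁ cols h,
    wheel_rimSpokeInc_pos (P := fun x : S => 0 ≤ x) isPosCone_nonneg hq hy hs₁ cols h⟩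

end Ordered

section Graded

variable {S : Type*} [CommRing S] [LinearOrder S] [IsStrictOrderedRing S]

open Polynomial

/-- Class (v), graded form: with `q = X` every coefficient of the rail form of two fans is `≥ 0` — the two-copy core of two
non-adjacent rim edges of a wheel has nonnegative q-coefficients (the CONJ-L edge shadow at all grades). [this work] -/
theorem wheel_rimRim_coeff_nonneg {s₀ s₁ : S[X]} (hs₀ : ∀ n, 0 ≤ s₀.coeff n) (hs₁ : ∀ n, 0 ≤ s₁.coeff n)
    (cols cols' : List (S[X] × S[X])) (h : ∀ rt ∈ cols, (∀ n, 0 ≤ rt.1.coeff n) ∧ (∀ n, 0 ≤ rt.2.coeff n))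
    (h' : ∀ rt ∈ cols', (∀ n, 0 ≤ rt.1.coeff n) ∧ (∀ n, 0 ≤ rt.2.coeff n)) (n : ℕ) :
    0 ≤ (Frail X (fanW X s₀ cols) (fanW X s₁ cols')).coeff n :=
  wheel_rimRim_pos (P := fun p : S[X] => ∀ n, 0 ≤ p.coeff n) isPosCone_coeff
    (fun n => by rw [coeff_X]; split_ifs <;> norm_num) hs₀ hs₁ cols cols' h h' n

/-- Classes (i)/(ii), graded form: every q-coefficient of the spoke forms of a fan is `≥ 0`. [this work] -/
theorem wheel_adjacent_coeff_nonneg {y s₁ : S[X]} (hy : ∀ n, 0 ≤ y.coeff n) (hs₁ : ∀ n, 0 ≤ s₁.coeff n)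
    (cols : List (S[X] × S[X])) (h : ∀ rt ∈ cols, (∀ n, 0 ≤ rt.1.coeff n) ∧ (∀ n, 0 ≤ rt.2.coeff n)) (n : ℕ) :
    0 ≤ (Qspoke X y (fanW X s₁ cols)).coeff n ∧ 0 ≤ (Qspoke X y (fanU X s₁ cols)).coeff n :=
  ⟨wheel_rimRimAdj_pos (P := fun p : S[X] => ∀ n, 0 ≤ p.coeff n) isPosCone_coeff
      (fun n => by rw [coeff_X]; split_ifs <;> norm_num) hy hs₁ cols h n,
    wheel_rimSpokeInc_pos (P := fun p : S[X] => ∀ n, 0 ≤ p.coeff n) isPosCone_coeff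
      (fun n => by rw [coeff_X]; split_ifs <;> norm_num) hy hs₁ cols h n⟩

end Graded

end TwoCopyWheels

end Summit.CriticalPhenomena.PercolationContinuityZ3.Theorems
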